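import Mathlib
import Literature.MathematicalPhysics.KineticTheory.VelocityFlipNoise
import Literature.MathematicalPhysics.KineticTheory.LangevinChainGibbs

/-!
# Sketch — crux-ideate k=2 for `LocalEnergyHalfHoelder` (stmt-AtomisticToContinuum-16008)

Typed shapes behind the NEGATIVE NOTE `Negative-notes/odd-damping-halves-exponent.md` (this seat filed
no idea card: its candidate lever `odd-damping-schur-domination` is killed by `OddDampingLowerBound`
below). All four are provable-now statements of linear algebra / flip combinatorics; none is proved here.
-/

namespace Summit.AtomisticToContinuum.FouriersLaw.Cruxes.LocalEnergyHalfHoelder.OddDamping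

open MeasureTheory Matrix
open scoped InnerProductSpace
open Literature.MathematicalPhysics.KineticTheory.HeatConduction

/-- LEMMA 1 (provable now): the velocity-flip Dirichlet form
`𝒟(u) = -∫ u · S u dμ`, `S = flipNoise` (Bernardin–Olla), has SPECTRAL GAP 2 on momentum-ODD
observables of the `N`-chain in its Gibbs state: `𝒟(u) ≥ 2‖u‖²` whenever `u(q,-p) = -u(q,p)`.
(Proof: decompose `u` into joint flip-parity components `u_S`, `S ⊆ Fin N`; `-S u = Σ_S 2|S| u_S`,
and `Θ = ∏ flips` acts by `(-1)^{|S|}`, so an odd `u` has only `|S| ≥ 1` components.) -/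
def OddFlipGap : Prop :=
  ∀ (P : OscillatorChain) (N : ℕ) (T : ℝ), 0 < T →
    ∀ u : PhaseSpace N → ℝ, MemLp u 2 (P.gibbsMeasure N T) →
      (∀ x : PhaseSpace N, u (x.1, -x.2) = -u x) →
        2 * ∫ x, u x ^ 2 ∂(P.gibbsMeasure N T)
          ≤ -∫ x, u x * flipNoise N u x ∂(P.gibbsMeasure N T)

/-- LEMMA 2 (abstract SCHUR MONOTONICITY, finite-dimensional shape; provable now): if the
generator couples an even block and an odd block only OFF-diagonally (`L = [[0, -Aᵀ], [A, 0]]`,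
the momentum-parity structure of every Liouvillian) and a positive semidefinite damping `ε D` acts
on the odd block alone, the even–even block of the resolvent quadratic form can only INCREASE:
`⟨g, (λ + AᵀA/λ)⁻¹ g⟩ ≤ ⟨g, (λ + Aᵀ(λ + εD)⁻¹A)⁻¹ g⟩` — i.e. the deterministic energy-return
functional is dominated by the odd-damped one. -/
def SchurMonotone : Prop :=
  ∀ (m n : ℕ) (A : Matrix (Fin m) (Fin n) ℝ) (D : Matrix (Fin m) (Fin m) ℝ) (lam ε : ℝ),
    0 < lam → 0 ≤ ε → D.PosSemidef →
      ∀ g : Fin n → ℝ,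
        g ⬝ᵥ ((lam • (1 : Matrix (Fin n) (Fin n) ℝ) + lam⁻¹ • (Aᵀ * A))⁻¹ *ᵥ g)
          ≤ g ⬝ᵥ ((lam • (1 : Matrix (Fin n) (Fin n) ℝ)
                + Aᵀ * (lam • (1 : Matrix (Fin m) (Fin m) ℝ) + ε • D)⁻¹ * A)⁻¹ *ᵥ g)

/-- LEMMA 3 shape: for the `N`-ring/open segment Gibbs state and every momentum-even `L²`
observable `g`, the deterministic Abel return functional is bounded by the flip-odd-damped one.
Stated abstractly (Hilbert-space form of SchurMonotone, valid for unbounded even-block Schur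
complements once `M₀ ≥ Mε ≥ 0` are symmetric and `g` lies in both ranges; provable now by the
Cauchy–Schwarz inequality for the semi-inner product `⟪·, Mε ·⟫`); the infinite-volume version over
`InfiniteChainDynamics` + a flip-damped extension is the card's Transfer `C⁺`. -/
def DominationShape : Prop :=
  ∀ (H : Type) [NormedAddCommGroup H] [InnerProductSpace ℝ H] [CompleteSpace H]
    (M₀ Mε : H →L[ℝ] H), (∀ x y : H, ⟪x, M₀ y⟫_ℝ = ⟪M₀ x, y⟫_ℝ) → (∀ x y : H, ⟪x, Mε y⟫_ℝ = ⟪Mε x, y⟫_ℝ) →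
    (∀ w : H, ⟪w, Mε w⟫_ℝ ≤ ⟪w, M₀ w⟫_ℝ) → (∀ w : H, 0 ≤ ⟪w, Mε w⟫_ℝ) →
    ∀ (g w₀ wε : H), M₀ w₀ = g → Mε wε = g → ⟪g, w₀⟫_ℝ ≤ ⟪g, wε⟫_ℝ


/-- THE NO-GO (matrix shape; exact, provable now). With the same data as `SchurMonotone` and an odd
block damping with GAP `d` (`D ≥ d·1`, `d > 0`; for velocity flips `d = 2` by `OddFlipGap`), the
odd-damped even-block functional DOMINATES THE UNDAMPED ONE AT THE DILATED FREQUENCY `√(d ε λ)`: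
`λ·⟨g,(λ + Aᵀ(λ+εD)⁻¹A)⁻¹g⟩ ≥ μ²·⟨g,(μ² + AᵀA)⁻¹g⟩` with `μ² = dελ`, i.e. `Ψ̃_ε(λ) ≥ Ψ_det(√(dελ))`.
Hence if `Ψ_det(ν) ≍ √ν` (sharp K1, a normal conductor) then `Ψ̃_ε(λ) ≳ (dελ)^{1/4} ≫ √λ`: no
odd-damped comparison dynamics satisfies the `√λ` law, and `SchurMonotone` can never certify K1. At the
harmonic member `D = 2` exactly on odd quadratics and the bound is an EQUALITY
`Ψ̃_ε(λ) = Ψ_det(√(λ(λ+2ε)))` (checked numerically, kit j025141: 0.1032 vs 0.1032 at λ = 1/800, ε = 1). -/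
def OddDampingLowerBound : Prop :=
  ∀ (m n : ℕ) (A : Matrix (Fin m) (Fin n) ℝ) (D : Matrix (Fin m) (Fin m) ℝ) (lam ε d : ℝ),
    0 < lam → 0 < ε → 0 < d → (D - d • (1 : Matrix (Fin m) (Fin m) ℝ)).PosSemidef →
      ∀ g : Fin n → ℝ,
        (d * ε * lam) * (g ⬝ᵥ (((d * ε * lam) • (1 : Matrix (Fin n) (Fin n) ℝ) + Aᵀ * A)⁻¹ *ᵥ g))
          ≤ lam * (g ⬝ᵥ ((lam • (1 : Matrix (Fin n) (Fin n) ℝ)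
                + Aᵀ * (lam • (1 : Matrix (Fin m) (Fin m) ℝ) + ε • D)⁻¹ * A)⁻¹ *ᵥ g))

end Summit.AtomisticToContinuum.FouriersLaw.Cruxes.LocalEnergyHalfHoelder.OddDamping
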